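import Literature.NumberTheory.EllipticCurves.TianYuanZhang2017.CMPointCompositumDisplays
import Literature.NumberTheory.EllipticCurves.TianYuanZhang2017.RhoIndexMonskyKernelOdd
import HarnessLib

/-!
# Tian–Yuan–Zhang 2017, Theorem 3.5 (main clause) AT EVERY BLOCK `d₀ ∣ n`, `d₀ ≡ 5, 6, 7 (mod 8)`, read in `A(ℍ′_n)` — DISPLAY
# (one predicate, one named fact refining `tyz_cmPointCompositumData`), and the package-level consequence for PRIME blocks

Companion to `GenusPointDescentDisplays.lean` (`structure GenusPointData n`; `GenusPointData.thm35Main` = Thm. 3.5's main clause for `n`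
ITSELF) and `CMPointCompositumDisplays.lean` (the CM-point layer and the compositum sentence; named fact `tyz_cmPointCompositumData`).

THE GAP THIS FILE CLOSES.  The package `D : GenusPointData n` carries TYZ's points `P(d)` for EVERY divisor `d ≡ 5, 6, 7 (mod 8)` of `n`
(the recursion `GenusPointData.recursion` is displayed at every such `d`, p0011 L67–L73: "Define `P(n) ∈ A(ℍ′_n)` inductively by
`P(n) := Z(n) − Σ ε(d₀,d₁)𝓛(d₁)P(d₀)`" — the `P(d₀)` on the right ARE the points of the blocks), but Theorem 3.5's main clause
("`𝒫(n) := 2^{−1−ρ(n)}𝓛(n)α_n` … is represented by the point `P(n) ∈ A(ℍ′_n)`", p0011 L27–L36, L94–L95) is displayed ONLY at `d = n`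
(`thm35Main`, whose first binder `hn : n ∈ n.divisors` is the vestige of the intended generality).  The source states Theorem 3.5 for
every positive square-free `n ≡ 5, 6, 7 (mod 8)`, hence for every block `d₀` of `n`; `P(d₀) ∈ A(ℍ′_{d₀}) ⊆ A(ℍ′_n)` (`ℍ′_{d₀} ⊆ ℍ′_n`:
`L_{d₀}(i) ⊆ L_n(i)` and the blocks of `d₀` are blocks of `n`, p0011 L58–L62), `K_{d₀} ⊆ ℍ′_n` (p0011 L64), and being torsion is preserved
under `A(ℍ′_{d₀}) ⊆ A(ℍ′_n)`; and the source USES the theorem at the blocks inside `A(ℍ′_n)`: "It suffices to prove that the above formula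
(applied to every `P(d₀)` below) …" (proof of Prop. 3.4, p0016 L93), "It follows that `𝒫(n)` and `P(n)` satisfy the same iteration formula …
Therefore `P(n)` represents `𝒫(n)`" (proof of Thm. 3.5, p0019 L36–L39 — an induction over the blocks).  THIS file displays exactly that:
**(B) for every `d ∣ n` with `d ≡ 5, 6, 7 (mod 8)`, Theorem 3.5's main clause for `d`, read in `A(ℍ′_n)`** (`thm35MainAt`, the text of
`thm35Main` with `n ↦ d`; at `d = n` it IS `thm35Main`: `thm35Main_iff_forall_thm35MainAt_self`, `Iff.rfl`), packaged as `Thm35AtBlocks`,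
and ONE named fact `tyz_genusPointBlockData` asserting that TYZ's data satisfy `Printed ∧ CMPointCompositumPrinted ∧ Thm35AtBlocks` — true
of the source's own `ℍ′_n`, `P(d)`, `𝓛(d)`; it refines `tyz_cmPointCompositumData` (proved in §4), hence every earlier `tyz_…Data`.

WHY (consumer).  The LEAD lineage of crux stmt-BirchSwinnertonDyer-20509 (`Summits/…/Theorems/PrintCf2RamifiedOffTYZLevelTwoTwoPrimes.lean`
g10, `…RankZeroDigitDepthTwo.lean` / `…RankZeroDigitInvisible.lean` g25, `…PrimeBlockDigits.lean` g26) reads C⁺ on the two-prime sectors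
`n = l·m` through the recursion `P(lm) = Z(lm) ∓ 𝓛(l)·P(m)` and needs Theorem 3.5 AT THE PRIME BLOCK `m` ("`2·P(m) − u·𝓛(m)·α_m` is torsion in
`A(ℍ′_{lm})`", their hypothesis `h35m`), which no display provided; with (B) it is a theorem (`Thm35AtBlocks.exists_two_smul_P_sub_smul_prime`,
§4: for a prime block `q ≡ 5, 7 (mod 8)` — `ρ(q) = 0` by the tree theorem `RhoMonskyKernel.rhoIndex_eq_one_of_odd_prime` — and every generator
`α` of the free part of `A(K_q)⁻`: `2·P(q) − (s·𝓛(q))·α` is torsion for a sign `s`, provided `𝓛(q) ≠ 0`).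

HONEST FRAMING: §1–§3 are a display (one predicate for one printed theorem read at the blocks, on named objects) and ONE named fact; nothing
in §1–§3 is asserted (no `_holds`: Heegner points, Yuan–Zhang–Zhang's Gross–Zagier formula — none in Mathlib), no count moves; consumers take
`(h : tyz_genusPointBlockData)` as an explicit hypothesis.  The display adds NO mathematical content beyond the page (it is Theorem 3.5
instantiated at `n := d₀` and read along `A(ℍ′_{d₀}) ⊆ A(ℍ′_n)`); the sign `s = ±1` and the hypothesis-shaped `GeneratesFreePart` are
exactly those of `thm35Main` (ML-52 (4), referee (γ)).  Net debt of this file: +1 (a display; no research content).  Typed by the LEAD of crux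
stmt-BirchSwinnertonDyer-20509 (cruxlead-20509 g26, cell `bsd-print-cf2`).  BSD is not proved by any of this; no class is closed by this file.

References: [TianYuanZhang2017] Y. Tian, X. Yuan, S.-W. Zhang, *Genus periods, genus points and congruent number problem*, Asian J. Math. 21
(2017) 721–774 = arXiv:1411.4728: §3.1 (chunk p0011 L27–L36, L53–L73, L94–L95), proof of Prop. 3.4 (p0016 L93), proof of Thm. 3.5 (p0019
L36–L39); the cell note `Summits/BirchSwinnertonDyer/BirchSwinnertonDyer/Cruxes/RamifiedOffTYZOfFacts/Lines/offtyz_v7.md` (cycle 27 §).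
-/

noncomputable section

open scoped Classical

open WeierstrassCurve

namespace Literature.NumberTheory.EllipticCurves.TianYuanZhang2017

namespace GenusPointData

variable {n : ℕ}

/-! ## §1 Theorem 3.5's main clause at a block `d ∣ n`, read in `A(ℍ′_n)` -/

/-- **Theorem 3.5, main clause, for the divisor `d` of `n`, read in `A(ℍ′_n)`** — the text of `thm35Main` with `n ↦ d`: for every `ρ`
with `[E_d(ℚ) : φ_d(A_d(ℚ)) + E_d[2]] = 2^ρ`: if `𝓛(d) = 0` then `P(d)` is torsion; if `𝓛(d) ≠ 0` then for every `α` generating the free part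
of `A(K_d)⁻`, `2^{1+ρ}·P(d) − s·𝓛(d)·α` is torsion in `A(ℍ′_n)` for a sign `s = ±1` (`K_d ⊂ ℍ′_n` by `embK d hd`).  A predicate; nothing
asserted. [cite: TianYuanZhang2017, Thm. 3.5 (chunk p0011 L94–L95) with §3.1 (p0011 L27–L36, L67–L73); proof of Prop. 3.4 (p0016 L93); proof of Thm. 3.5 (p0019 L36–L39)] -/
def thm35MainAt (D : GenusPointData n) (d : ℕ) (hd : d ∈ n.divisors) : Prop :=
  ∀ (ρ : ℕ), (rhoSubgroup d).index = 2 ^ ρ →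
    (D.scriptL d = 0 → IsOfFinAddOrder (D.P d)) ∧
    (D.scriptL d ≠ 0 → ∀ α : APoint (GenusField d), GeneratesFreePart d α →
      ∃ s : ℤ, (s = 1 ∨ s = -1) ∧
        IsOfFinAddOrder (((2 : ℤ) ^ (ρ + 1)) • D.P d -
          (s * D.scriptL d) • WeierstrassCurve.Affine.Point.map (D.embK d hd) α))

/-- At `d = n` the block reading IS the displayed `thm35Main` (definitional). [cite: TianYuanZhang2017, Thm. 3.5 (chunk p0011 L94–L95)] -/
theorem thm35Main_iff_forall_thm35MainAt_self (D : GenusPointData n) :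
    D.thm35Main ↔ ∀ hn : n ∈ n.divisors, D.thm35MainAt n hn :=
  Iff.rfl

/-! ## §2 Theorem 3.5 at ALL blocks -/

/-- **(B) Theorem 3.5's main clause at every block `d ∣ n`, `d ≡ 5, 6, 7 (mod 8)`, read in `A(ℍ′_n)`.**  A predicate; nothing asserted.
[cite: TianYuanZhang2017, Thm. 3.5 (chunk p0011 L94–L95); proof of Prop. 3.4 (p0016 L93: "applied to every P(d₀)"); proof of Thm. 3.5 (p0019 L36–L39)] -/
def Thm35AtBlocks (D : GenusPointData n) : Prop :=
  ∀ (d : ℕ) (hd : d ∈ n.divisors), (d % 8 = 5 ∨ d % 8 = 6 ∨ d % 8 = 7) → D.thm35MainAt d hd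

/-- (B) contains the displayed `thm35Main` (the block `d = n`, for `n ≡ 5, 6, 7 (mod 8)`). [cite: TianYuanZhang2017, Thm. 3.5 (chunk p0011 L94–L95)] -/
theorem Thm35AtBlocks.thm35Main {D : GenusPointData n} (h : D.Thm35AtBlocks) (h8 : n % 8 = 5 ∨ n % 8 = 6 ∨ n % 8 = 7) :
    D.thm35Main :=
  fun hn => h n hn h8

/-! ## §3 The ONE named fact -/

end GenusPointData

/-- **Tian–Yuan–Zhang 2017, §3 with the CM-point layer and the compositum sentence (exactly `tyz_cmPointCompositumData`) AND Theorem 3.5's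
main clause at every block, AS PRINTED, as ONE named fact**: for every positive square-free `n ≡ 5, 6, 7 (mod 8)` there are data
`D : GenusPointData n` satisfying `Printed`, `CMPointCompositumPrinted` and `Thm35AtBlocks`.  Constructed in the source from the CM points on
`X_U → A` (§3.1–3.2), Yuan–Zhang–Zhang's Gross–Zagier formula (Thm. 3.3) and class field theory, Theorem 3.5 being a theorem for every
`n ≡ 5, 6, 7 (mod 8)` and so for every block; no `_holds` expected.  Refines `tyz_cmPointCompositumData` (§4).  Consumers take it as an explicit
hypothesis; nothing is asserted here.
[cite: TianYuanZhang2017, §3: §3.1 (p0011 L1–L73), Prop. 3.4, Thm. 3.5 (p0011 L94–L112), proof of Prop. 3.4 (p0016 L93), proof of Thm. 3.5 (p0019 L36–L39), Thm. 3.6, Lemma 3.18, Lemma 3.21] -/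
def tyz_genusPointBlockData : Prop :=
  ∀ (n : ℕ), Squarefree n → (n % 8 = 5 ∨ n % 8 = 6 ∨ n % 8 = 7) →
    ∃ D : GenusPointData n, D.Printed ∧ D.CMPointCompositumPrinted ∧ D.Thm35AtBlocks

/-! ## §4 Proved consequences: the refinement, and Theorem 3.5 at a PRIME block (`ρ = 0`) -/

/-- `tyz_genusPointBlockData ⟹ tyz_cmPointCompositumData` (drop (B)). [cite: TianYuanZhang2017, §3.1, Thm. 3.5] -/
theorem tyz_cmPointCompositumData_of_blockData (h : tyz_genusPointBlockData) : tyz_cmPointCompositumData :=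
  fun n hsq h8 => by
    obtain ⟨D, hP, hC, -⟩ := h n hsq h8
    exact ⟨D, hP, hC⟩

namespace GenusPointData

variable {n : ℕ}

/-- **Theorem 3.5 at a PRIME block `q ≡ 5, 7 (mod 8)` of `n`:** `ρ(q) = 0` for every odd prime (tree theorem
`RhoMonskyKernel.rhoIndex_eq_one_of_odd_prime`), so if `𝓛(q) ≠ 0` then for every generator `α` of the free part of `A(K_q)⁻`,
**`2·P(q) − (s·𝓛(q))·α` is torsion in `A(ℍ′_n)` for a sign `s = ±1`** — the hypothesis `h35m`/`h35q` of the crux-20509 lineage, by name.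
[cite: TianYuanZhang2017, Thm. 3.5 (chunk p0011 L94–L95), §1 (p0002 L101–L103: ρ)] -/
theorem Thm35AtBlocks.exists_two_smul_P_sub_smul_prime {D : GenusPointData n} (h : D.Thm35AtBlocks) {q : ℕ} (hq : q.Prime)
    (hq8 : q % 8 = 5 ∨ q % 8 = 7) (hqd : q ∈ n.divisors) (hL : D.scriptL q ≠ 0) (α : APoint (GenusField q))
    (hα : GeneratesFreePart q α) :
    ∃ s : ℤ, (s = 1 ∨ s = -1) ∧
      IsOfFinAddOrder ((2 : ℤ) • D.P q - (s * D.scriptL q) • WeierstrassCurve.Affine.Point.map (D.embK q hqd) α) := by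
  have hρ : (rhoSubgroup q).index = 2 ^ 0 := by
    rw [pow_zero]; exact RhoMonskyKernel.rhoIndex_eq_one_of_odd_prime hq (by omega)
  obtain ⟨s, hs, ht⟩ := (h q hqd (by omega) 0 hρ).2 hL α hα
  exact ⟨s, hs, by simpa using ht⟩

/-- **Theorem 3.5 at a block `d` with `𝓛(d) = 0`:** `P(d)` is torsion in `A(ℍ′_n)`. [cite: TianYuanZhang2017, Thm. 3.5 (chunk p0011 L94–L95), §3.1 (p0011 L36: "𝒫(n) = 0 if 𝓛(n) = 0")] -/
theorem Thm35AtBlocks.isOfFinAddOrder_P_of_scriptL_eq_zero {D : GenusPointData n} (h : D.Thm35AtBlocks) {d : ℕ}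
    (hd : d ∈ n.divisors) (hd8 : d % 8 = 5 ∨ d % 8 = 6 ∨ d % 8 = 7) {ρ : ℕ} (hρ : (rhoSubgroup d).index = 2 ^ ρ)
    (hL : D.scriptL d = 0) : IsOfFinAddOrder (D.P d) :=
  (h d hd hd8 ρ hρ).1 hL

end GenusPointData

end Literature.NumberTheory.EllipticCurves.TianYuanZhang2017

end
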